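import Mathlib
import Summits.Ventures.PercRepro2.HCov
import Summits.Ventures.PercRepro2.HCovCubic
import Summits.Ventures.PercRepro2.TriDisagreement
import Summits.Ventures.PercRepro2.TriDisagreementPinned
import Summits.Ventures.PercRepro2.TypedSplit
import Summits.Ventures.PercRepro2.OneTypedEdge
import Summits.Ventures.PercRepro2.TypedSeries
import Summits.Ventures.PercRepro2.StarPattern

/-!
# Twin stars: moving edges between two unmarked vertices on the same neighbours (blind cell
PercRepro2, p1 g12; the graph-row reading of the triangle base `B(△₁)`, part I)

Two graph lemmas behind «the triangle base is a typed count of the twin-star graph»: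

* **`conn_update_true_of_conn`**: opening an edge whose endpoints are already connected changes
  no connection (closed-set argument); **`conn_update_false_of_conn`**: closing an edge whose
  endpoints stay connected without it changes no connection;
* **`conn_move_twin`**: if `y`, `y'` share an open neighbour `u_k` (`s_k`, `t_k` open) and `t_i`
  (`y'`–`u_i`) is open, then moving `t_i` to `s_i` (`y`–`u_i`) changes no connection at all.

With the pendant lemma `conn_update_false_pendant` (an edge at a vertex all of whose other edges
are closed may be closed or opened without changing the connections off that vertex) these let a
block of `y'` be transferred to `y` one edge at a time (`StarTwinMerge.lean`). The file also holds
the normal form `cfg` of a two-star configuration and the data `TwinStar` / `TwinClosed`.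
-/

namespace Summit.Ventures.PercRepro2

open CovForm CovForm.OneTyped CovForm.TypedRed

namespace StarPattern

section Moves

variable {V : Type*} {E : Type*} [DecidableEq E]

/-- **Opening an edge between connected vertices changes no connection.** -/
theorem conn_update_true_of_conn {ends : E → Sym2 V} {ω : Config E} {e : E} {u v : V}
    (he : ends e = s(u, v)) (huv : Conn ends ω u v) (a b : V) :
    Conn ends ω a b ↔ Conn ends (Function.update ω e true) a b := by
  constructor
  · intro h
    refine conn_mono (fun g => ?_) h
    by_cases hg : g = e
    · subst hg; simp
    · rw [Function.update_of_ne hg]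
  · intro h
    let S : Set V := {x | Conn ends ω a x}
    have hS : ∀ x ∈ S, ∀ z, (openGraph ends (Function.update ω e true)).Adj x z → z ∈ S := by
      intro x hx z hadj
      obtain ⟨_, g, hgo, hge⟩ := openGraph_adj.1 hadj
      by_cases hg : g = e
      · subst hg
        rw [he, Sym2.eq_iff] at hge
        rcases hge with ⟨rfl, rfl⟩ | ⟨rfl, rfl⟩
        · exact conn_trans hx huv
        · exact conn_trans hx (conn_symm huv)
      · rw [Function.update_of_ne hg] at hgo
        exact conn_trans hx (conn_of_openAdj ⟨g, hgo, hge⟩)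
    exact mem_of_conn_of_closed hS (conn_refl ends ω a) h

/-- **Closing an edge whose endpoints stay connected without it changes no connection.** -/
theorem conn_update_false_of_conn {ends : E → Sym2 V} {ω : Config E} {e : E} {u v : V}
    (he : ends e = s(u, v)) (hωe : ω e = true)
    (huv : Conn ends (Function.update ω e false) u v) (a b : V) :
    Conn ends ω a b ↔ Conn ends (Function.update ω e false) a b := by
  have h := conn_update_true_of_conn he huv a b
  rw [Function.update_idem, update_self_of_eq ω e true hωe] at h
  exact h.symm

/-- **Moving an edge of `y'` to `y`**: with `s_k = {y, u_k}` and `t_k = {y', u_k}` open and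
`t_i = {y', u_i}` open, opening `s_i = {y, u_i}` and closing `t_i` changes no connection. -/
theorem conn_move_twin {ends : E → Sym2 V} {ω : Config E} {sk tk si ti : E} {y y' uk ui : V}
    (hsk : ends sk = s(y, uk)) (htk : ends tk = s(y', uk)) (hsi : ends si = s(y, ui))
    (hti : ends ti = s(y', ui)) (hsk_si : sk ≠ si) (hsk_ti : sk ≠ ti) (htk_si : tk ≠ si)
    (htk_ti : tk ≠ ti) (hsi_ti : si ≠ ti) (hsk_o : ω sk = true) (htk_o : ω tk = true)
    (hti_o : ω ti = true) (a b : V) :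
    Conn ends ω a b ↔ Conn ends (Function.update (Function.update ω si true) ti false) a b := by
  -- `y ~ u_i` in `ω`: `y – u_k – y' – u_i`
  have hy_ui : Conn ends ω y ui :=
    conn_trans (conn_of_openAdj ⟨sk, hsk_o, hsk⟩)
      (conn_trans (conn_symm (conn_of_openAdj ⟨tk, htk_o, htk⟩)) (conn_of_openAdj ⟨ti, hti_o, hti⟩))
  rw [conn_update_true_of_conn hsi hy_ui a b]
  have h1 : Function.update ω si true ti = true := by
    rw [Function.update_of_ne hsi_ti.symm]; exact hti_o
  -- in `ω[s_i ↦ open][t_i ↦ closed]`, `y' ~ u_i`: `y' – u_k – y – u_i`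
  have e1 : Function.update (Function.update ω si true) ti false tk = true := by
    rw [Function.update_of_ne htk_ti, Function.update_of_ne htk_si]; exact htk_o
  have e2 : Function.update (Function.update ω si true) ti false sk = true := by
    rw [Function.update_of_ne hsk_ti, Function.update_of_ne hsk_si]; exact hsk_o
  have e3 : Function.update (Function.update ω si true) ti false si = true := by
    rw [Function.update_of_ne hsi_ti, Function.update_self]
  have hpath : Conn ends (Function.update (Function.update ω si true) ti false) y' ui :=
    conn_trans (conn_of_openAdj ⟨tk, e1, htk⟩)
      (conn_trans (conn_symm (conn_of_openAdj ⟨sk, e2, hsk⟩)) (conn_of_openAdj ⟨si, e3, hsi⟩))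
  exact conn_update_false_of_conn hti h1 hpath a b

end Moves

section Cfg

variable {V : Type*} {E : Type*} [DecidableEq E]

/-- The configuration with the two stars set to the bits `(p₁, p₂, p₃)` at `y` and `(q₁, q₂, q₃)`
at `y'`. -/
def cfg (s₁ s₂ s₃ t₁ t₂ t₃ : E) (x : Config E) (p₁ p₂ p₃ q₁ q₂ q₃ : Bool) : Config E :=
  Function.update (Function.update (Function.update (Function.update (Function.update
    (Function.update x s₁ p₁) s₂ p₂) s₃ p₃) t₁ q₁) t₂ q₂) t₃ q₃

/-- The standing distinctness of the six star edges. -/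
structure TwinEdges (s₁ s₂ s₃ t₁ t₂ t₃ : E) : Prop where
  h12 : s₁ ≠ s₂
  h13 : s₁ ≠ s₃
  h23 : s₂ ≠ s₃
  g12 : t₁ ≠ t₂
  g13 : t₁ ≠ t₃
  g23 : t₂ ≠ t₃
  c11 : s₁ ≠ t₁
  c12 : s₁ ≠ t₂
  c13 : s₁ ≠ t₃
  c21 : s₂ ≠ t₁
  c22 : s₂ ≠ t₂
  c23 : s₂ ≠ t₃
  c31 : s₃ ≠ t₁
  c32 : s₃ ≠ t₂
  c33 : s₃ ≠ t₃

variable {s₁ s₂ s₃ t₁ t₂ t₃ : E}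

/-- `cfg` as an explicit six-way update. -/
lemma cfg_apply (x : Config E) (p₁ p₂ p₃ q₁ q₂ q₃ : Bool) (g : E) :
    cfg s₁ s₂ s₃ t₁ t₂ t₃ x p₁ p₂ p₃ q₁ q₂ q₃ g =
      if g = t₃ then q₃ else if g = t₂ then q₂ else if g = t₁ then q₁ else if g = s₃ then p₃
        else if g = s₂ then p₂ else if g = s₁ then p₁ else x g := by
  unfold cfg
  simp only [Function.update_apply]

/-- Updating one star edge of a `cfg` is a `cfg`. -/
lemma update_cfg_s₁ (T : TwinEdges s₁ s₂ s₃ t₁ t₂ t₃) (x : Config E) (p₁ p₂ p₃ q₁ q₂ q₃ v : Bool) :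
    Function.update (cfg s₁ s₂ s₃ t₁ t₂ t₃ x p₁ p₂ p₃ q₁ q₂ q₃) s₁ v =
      cfg s₁ s₂ s₃ t₁ t₂ t₃ x v p₂ p₃ q₁ q₂ q₃ := by
  funext g
  rw [Function.update_apply, cfg_apply, cfg_apply]
  obtain ⟨h12, h13, h23, g12, g13, g23, c11, c12, c13, c21, c22, c23, c31, c32, c33⟩ := T
  split_ifs <;> simp_all

/-- Updating `s₂` of a `cfg` is a `cfg`. -/
lemma update_cfg_s₂ (T : TwinEdges s₁ s₂ s₃ t₁ t₂ t₃) (x : Config E) (p₁ p₂ p₃ q₁ q₂ q₃ v : Bool) :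
    Function.update (cfg s₁ s₂ s₃ t₁ t₂ t₃ x p₁ p₂ p₃ q₁ q₂ q₃) s₂ v =
      cfg s₁ s₂ s₃ t₁ t₂ t₃ x p₁ v p₃ q₁ q₂ q₃ := by
  funext g
  rw [Function.update_apply, cfg_apply, cfg_apply]
  obtain ⟨h12, h13, h23, g12, g13, g23, c11, c12, c13, c21, c22, c23, c31, c32, c33⟩ := T
  split_ifs <;> simp_all

/-- Updating `s₃` of a `cfg` is a `cfg`. -/
lemma update_cfg_s₃ (T : TwinEdges s₁ s₂ s₃ t₁ t₂ t₃) (x : Config E) (p₁ p₂ p₃ q₁ q₂ q₃ v : Bool) :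
    Function.update (cfg s₁ s₂ s₃ t₁ t₂ t₃ x p₁ p₂ p₃ q₁ q₂ q₃) s₃ v =
      cfg s₁ s₂ s₃ t₁ t₂ t₃ x p₁ p₂ v q₁ q₂ q₃ := by
  funext g
  rw [Function.update_apply, cfg_apply, cfg_apply]
  obtain ⟨h12, h13, h23, g12, g13, g23, c11, c12, c13, c21, c22, c23, c31, c32, c33⟩ := T
  split_ifs <;> simp_all

/-- Updating `t₁` of a `cfg` is a `cfg`. -/
lemma update_cfg_t₁ (T : TwinEdges s₁ s₂ s₃ t₁ t₂ t₃) (x : Config E) (p₁ p₂ p₃ q₁ q₂ q₃ v : Bool) :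
    Function.update (cfg s₁ s₂ s₃ t₁ t₂ t₃ x p₁ p₂ p₃ q₁ q₂ q₃) t₁ v =
      cfg s₁ s₂ s₃ t₁ t₂ t₃ x p₁ p₂ p₃ v q₂ q₃ := by
  funext g
  rw [Function.update_apply, cfg_apply, cfg_apply]
  obtain ⟨h12, h13, h23, g12, g13, g23, c11, c12, c13, c21, c22, c23, c31, c32, c33⟩ := T
  split_ifs <;> simp_all

/-- Updating `t₂` of a `cfg` is a `cfg`. -/
lemma update_cfg_t₂ (T : TwinEdges s₁ s₂ s₃ t₁ t₂ t₃) (x : Config E) (p₁ p₂ p₃ q₁ q₂ q₃ v : Bool) :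
    Function.update (cfg s₁ s₂ s₃ t₁ t₂ t₃ x p₁ p₂ p₃ q₁ q₂ q₃) t₂ v =
      cfg s₁ s₂ s₃ t₁ t₂ t₃ x p₁ p₂ p₃ q₁ v q₃ := by
  funext g
  rw [Function.update_apply, cfg_apply, cfg_apply]
  obtain ⟨h12, h13, h23, g12, g13, g23, c11, c12, c13, c21, c22, c23, c31, c32, c33⟩ := T
  split_ifs <;> simp_all

/-- Updating `t₃` of a `cfg` is a `cfg`. -/
lemma update_cfg_t₃ (x : Config E) (p₁ p₂ p₃ q₁ q₂ q₃ v : Bool) :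
    Function.update (cfg s₁ s₂ s₃ t₁ t₂ t₃ x p₁ p₂ p₃ q₁ q₂ q₃) t₃ v =
      cfg s₁ s₂ s₃ t₁ t₂ t₃ x p₁ p₂ p₃ q₁ q₂ v := by
  funext g
  rw [Function.update_apply, cfg_apply, cfg_apply]
  split_ifs <;> simp_all

/-- The value of a `cfg` at `s₁`. -/
lemma cfg_s₁ (T : TwinEdges s₁ s₂ s₃ t₁ t₂ t₃) (x : Config E) (p₁ p₂ p₃ q₁ q₂ q₃ : Bool) :
    cfg s₁ s₂ s₃ t₁ t₂ t₃ x p₁ p₂ p₃ q₁ q₂ q₃ s₁ = p₁ := by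
  rw [cfg_apply]; simp [T.c13, T.c12, T.c11, T.h13, T.h12]
/-- The value of a `cfg` at `s₂`. -/
lemma cfg_s₂ (T : TwinEdges s₁ s₂ s₃ t₁ t₂ t₃) (x : Config E) (p₁ p₂ p₃ q₁ q₂ q₃ : Bool) :
    cfg s₁ s₂ s₃ t₁ t₂ t₃ x p₁ p₂ p₃ q₁ q₂ q₃ s₂ = p₂ := by
  rw [cfg_apply]; simp [T.c23, T.c22, T.c21, T.h23]
/-- The value of a `cfg` at `s₃`. -/
lemma cfg_s₃ (T : TwinEdges s₁ s₂ s₃ t₁ t₂ t₃) (x : Config E) (p₁ p₂ p₃ q₁ q₂ q₃ : Bool) :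
    cfg s₁ s₂ s₃ t₁ t₂ t₃ x p₁ p₂ p₃ q₁ q₂ q₃ s₃ = p₃ := by
  rw [cfg_apply]; simp [T.c33, T.c32, T.c31]
/-- The value of a `cfg` at `t₁`. -/
lemma cfg_t₁ (T : TwinEdges s₁ s₂ s₃ t₁ t₂ t₃) (x : Config E) (p₁ p₂ p₃ q₁ q₂ q₃ : Bool) :
    cfg s₁ s₂ s₃ t₁ t₂ t₃ x p₁ p₂ p₃ q₁ q₂ q₃ t₁ = q₁ := by
  rw [cfg_apply]; simp [T.g13, T.g12]
/-- The value of a `cfg` at `t₂`. -/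
lemma cfg_t₂ (T : TwinEdges s₁ s₂ s₃ t₁ t₂ t₃) (x : Config E) (p₁ p₂ p₃ q₁ q₂ q₃ : Bool) :
    cfg s₁ s₂ s₃ t₁ t₂ t₃ x p₁ p₂ p₃ q₁ q₂ q₃ t₂ = q₂ := by
  rw [cfg_apply]; simp [T.g23]
/-- The value of a `cfg` at `t₃`. -/
lemma cfg_t₃ (x : Config E) (p₁ p₂ p₃ q₁ q₂ q₃ : Bool) :
    cfg s₁ s₂ s₃ t₁ t₂ t₃ x p₁ p₂ p₃ q₁ q₂ q₃ t₃ = q₃ := by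
  rw [cfg_apply]; simp

/-- A `cfg` with the `y'`-star closed on a configuration with the `y'`-star closed is `starSet`. -/
lemma cfg_eq_starSet (T : TwinEdges s₁ s₂ s₃ t₁ t₂ t₃) {x : Config E} (hx₁ : x t₁ = false)
    (hx₂ : x t₂ = false) (hx₃ : x t₃ = false) (p₁ p₂ p₃ : Bool) :
    cfg s₁ s₂ s₃ t₁ t₂ t₃ x p₁ p₂ p₃ false false false = starSet s₁ s₂ s₃ (p₁, p₂, p₃) x := by
  funext g
  rw [cfg_apply, starSet_apply T.h12 T.h13 T.h23]
  obtain ⟨h12, h13, h23, g12, g13, g23, c11, c12, c13, c21, c22, c23, c31, c32, c33⟩ := T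
  split_ifs <;> simp_all

end Cfg

section Data

variable {V : Type*} {E : Type*} [DecidableEq E] {ends : E → Sym2 V} {o a₁ a₂ a₃ b : V}
  {s₁ s₂ s₃ t₁ t₂ t₃ : E} {y y' u₁ u₂ u₃ : V}

/-- **Twin stars**: two distinct unmarked vertices `y`, `y'` with stars `s₁ s₂ s₃` and `t₁ t₂ t₃` to
the same neighbours `u₁ u₂ u₃`. -/
structure TwinStar (ends : E → Sym2 V) (o a₁ a₂ a₃ b : V) (s₁ s₂ s₃ t₁ t₂ t₃ : E)
    (y y' u₁ u₂ u₃ : V) : Prop where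
  T : TwinEdges s₁ s₂ s₃ t₁ t₂ t₃
  hs₁ : ends s₁ = s(y, u₁)
  hs₂ : ends s₂ = s(y, u₂)
  hs₃ : ends s₃ = s(y, u₃)
  ht₁ : ends t₁ = s(y', u₁)
  ht₂ : ends t₂ = s(y', u₂)
  ht₃ : ends t₃ = s(y', u₃)
  hyy' : y ≠ y'
  hyu₁ : y ≠ u₁
  hyu₂ : y ≠ u₂
  hyu₃ : y ≠ u₃
  hy'u₁ : y' ≠ u₁
  hy'u₂ : y' ≠ u₂
  hy'u₃ : y' ≠ u₃
  hyo : y ≠ o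
  hy1 : y ≠ a₁
  hy2 : y ≠ a₂
  hy3 : y ≠ a₃
  hyb : y ≠ b
  hy'o : y' ≠ o
  hy'1 : y' ≠ a₁
  hy'2 : y' ≠ a₂
  hy'3 : y' ≠ a₃
  hy'b : y' ≠ b

omit [DecidableEq E] in
/-- The state only depends on the connections. -/
lemma st_congr_of_conn {ω ω' : Config E} (h : ∀ a b : V, Conn ends ω a b ↔ Conn ends ω' a b) :
    st ends o a₁ a₂ a₃ b ω = st ends o a₁ a₂ a₃ b ω' := by
  unfold st
  simp only [Prod.mk.injEq]
  exact ⟨decide_eq_decide.mpr (h _ _), decide_eq_decide.mpr (h _ _), decide_eq_decide.mpr (h _ _),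
    decide_eq_decide.mpr (h _ _), decide_eq_decide.mpr (h _ _), decide_eq_decide.mpr (h _ _),
    decide_eq_decide.mpr (h _ _)⟩

/-- The value of a `cfg` off the six star edges. -/
lemma cfg_other (x : Config E) (p₁ p₂ p₃ q₁ q₂ q₃ : Bool) {g : E} (h1 : g ≠ s₁) (h2 : g ≠ s₂)
    (h3 : g ≠ s₃) (h4 : g ≠ t₁) (h5 : g ≠ t₂) (h6 : g ≠ t₃) :
    cfg s₁ s₂ s₃ t₁ t₂ t₃ x p₁ p₂ p₃ q₁ q₂ q₃ g = x g := by
  rw [cfg_apply, if_neg h6, if_neg h5, if_neg h4, if_neg h3, if_neg h2, if_neg h1]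

/-- The closure condition for `x` (every non-star edge at `y` or `y'` a loop or closed). -/
def TwinClosed (ends : E → Sym2 V) (s₁ s₂ s₃ t₁ t₂ t₃ : E) (y y' : V) (x : Config E) : Prop :=
  (∀ g, g ≠ s₁ → g ≠ s₂ → g ≠ s₃ → y ∈ ends g → (ends g).IsDiag ∨ x g = false) ∧
  (∀ g, g ≠ t₁ → g ≠ t₂ → g ≠ t₃ → y' ∈ ends g → (ends g).IsDiag ∨ x g = false)

omit [DecidableEq E] in
/-- `y'` is not on a `y`-star edge. -/
lemma TwinStar.y'_not_mem_s (W : TwinStar ends o a₁ a₂ a₃ b s₁ s₂ s₃ t₁ t₂ t₃ y y' u₁ u₂ u₃) :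
    y' ∉ ends s₁ ∧ y' ∉ ends s₂ ∧ y' ∉ ends s₃ := by
  refine ⟨?_, ?_, ?_⟩
  · rw [W.hs₁, Sym2.mem_iff, not_or]; exact ⟨W.hyy'.symm, W.hy'u₁⟩
  · rw [W.hs₂, Sym2.mem_iff, not_or]; exact ⟨W.hyy'.symm, W.hy'u₂⟩
  · rw [W.hs₃, Sym2.mem_iff, not_or]; exact ⟨W.hyy'.symm, W.hy'u₃⟩

omit [DecidableEq E] in
/-- `y` is not on a `y'`-star edge. -/
lemma TwinStar.y_not_mem_t (W : TwinStar ends o a₁ a₂ a₃ b s₁ s₂ s₃ t₁ t₂ t₃ y y' u₁ u₂ u₃) :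
    y ∉ ends t₁ ∧ y ∉ ends t₂ ∧ y ∉ ends t₃ := by
  refine ⟨?_, ?_, ?_⟩
  · rw [W.ht₁, Sym2.mem_iff, not_or]; exact ⟨W.hyy', W.hyu₁⟩
  · rw [W.ht₂, Sym2.mem_iff, not_or]; exact ⟨W.hyy', W.hyu₂⟩
  · rw [W.ht₃, Sym2.mem_iff, not_or]; exact ⟨W.hyy', W.hyu₃⟩

end Data

end StarPattern

end Summit.Ventures.PercRepro2
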